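import Summits.AtomisticToContinuum.FouriersLaw.Theses.OddSectorIrreversibility
import Summits.AtomisticToContinuum.FouriersLaw.Theses.StaticAbelianSqueeze
import Summits.AtomisticToContinuum.FouriersLaw.Theorems.OddSectorIrreversibilityBoundedResponse

/-!
# `BoundedResponse` ⟺ an `O(N)` bound on the equilibrium Green–Kubo integral, modulo the fixed-`N`
# Kubo identity (support for stmt-AtomisticToContinuum-10924)

The shared support item `OddSectorIrreversibility.BoundedResponse` (= the Barriers predicate
`HasBoundedResponse (pinnedChain ω₂ lam β γ)` under weak-NESS uniqueness: the finite-size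
conductivities `D_N` are bounded in `N`; Bonetto–Lebowitz–Rey-Bellet 2000 §6.3, open) is reached in
route `OddSectorIrreversibility` through the fixed-`N` open-system Green–Kubo identity — the second
conjunct of `CorrectorTheory` (stmt-14071), which is VERBATIM the `StaticAbelianSqueeze` crux
`KuboAbelIdentity` (stmt-13419):

  `(N - 1) · T² · D_N = GK_N(T) := ∫₀^∞ ∫ J · (P_t J) dπ_{N,T} dt`,

`J = ∑_i j_i` the total current, `P_t = transitionKernel N T T t` the equilibrium open kernels,
`π_{N,T} = gibbsMeasure N T`. This file records, sorry-free, that modulo this fixed-`N` identity the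
item is EXACTLY one `N`-uniform statement about the equilibrium dynamics, with no steady state at
`T_L ≠ T_R` and no response limit left in it:

* `kuboAbelIdentity_of_correctorTheory` — `CorrectorTheory → KuboAbelIdentity` (projection; the two
  routes' decls agree definitionally).
* `boundedResponse_of_kuboAbelIdentity_of_gk_abs_le` — if `KuboAbelIdentity` holds and, at every
  admissible parameter point and `T > 0`, `|GK_N(T)| ≤ C · N` for all large `N`, then
  `BoundedResponse` (`|D_N| ≤ 2C/T²` for `N ≥ 2`; finitely many `N` are free).
* `boundedResponse_of_correctorTheory_of_gk_abs_le` — the same from `CorrectorTheory`.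
* `gk_abs_le_of_boundedResponse` — conversely, `KuboAbelIdentity`, `FiniteResponseOfUnique`
  (existence of the `D_N`, stmt-0717) and `BoundedResponse` give, under weak-NESS uniqueness,
  `|GK_N(T)| ≤ C · N` for ALL `N` (a steady-state family exists by the landed
  `pinnedChain_exists_isSteadyState`; `GK_N` does not depend on the family).

So, given the fixed-`N` dictionary (`KuboAbelIdentity` + `FiniteResponseOfUnique`, both open but
`N`-by-`N` statements of hypoelliptic linear-response theory), `BoundedResponse` is equivalent to
"the time-integrated total-current autocorrelation of the EQUILIBRIUM boundary-damped chain is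
`O(N)`" — the Green–Kubo form in which `WitnessGlue` (this route), `closes` of
`StaticAbelianSqueeze` and `FourierGreenKubo.ThermodynamicLimit` all attack it. Nothing here closes
the item; every hypothesis is an open ledger item.
-/

noncomputable section

namespace Summit.AtomisticToContinuum.FouriersLaw.Theorems

open MeasureTheory Filter Topology Set
open Literature.MathematicalPhysics.KineticTheory.HeatConduction
open Summit.AtomisticToContinuum.FouriersLaw.Theses

/-- The open-system Green–Kubo conjunct of `CorrectorTheory` (route `OddSectorIrreversibility`,
stmt-14071) is verbatim the crux `KuboAbelIdentity` of route `StaticAbelianSqueeze` (stmt-13419):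
the projection closes it. [folklore] -/
theorem kuboAbelIdentity_of_correctorTheory (h : OddSectorIrreversibility.CorrectorTheory) :
    StaticAbelianSqueeze.KuboAbelIdentity :=
  h.2

/-- **Green–Kubo reduction of `BoundedResponse`.** If the fixed-`N` Kubo identity
`(N-1) T² D_N = GK_N(T)` holds (`KuboAbelIdentity`) and the equilibrium Green–Kubo integral
`GK_N(T) = ∫₀^∞ ∫ J (P_t J) dπ_{N,T} dt` of the total current is `O(N)` at every admissible parameter
point and temperature — `|GK_N(T)| ≤ C N` for all large `N` — then `BoundedResponse`: for `N ≥ 2`,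
`|D_N| = |GK_N| / ((N-1)T²) ≤ C N / ((N-1) T²) ≤ 2C/T²`, and finitely many `N` are free
(`bddAbove_range_abs_of_eventually_abs_le`). [folklore] -/
theorem boundedResponse_of_kuboAbelIdentity_of_gk_abs_le
    (hK : StaticAbelianSqueeze.KuboAbelIdentity)
    (hGK : ∀ ω₂ lam β γ : ℝ, 0 < ω₂ → 0 < lam → 0 < β → 0 < γ → ∀ T : ℝ, 0 < T →
      ∃ C : ℝ, ∀ᶠ N : ℕ in atTop,
        |∫ t in Ioi (0 : ℝ), ∫ z, (∑ i : Fin N, (pinnedChain ω₂ lam β γ).bondCurrent N i z) *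
            (∫ y, (∑ i : Fin N, (pinnedChain ω₂ lam β γ).bondCurrent N i y)
              ∂((pinnedChain ω₂ lam β γ).transitionKernel N T T t.toNNReal z))
          ∂((pinnedChain ω₂ lam β γ).gibbsMeasure N T)| ≤ C * N) :
    OddSectorIrreversibility.BoundedResponse := by
  intro ω₂ lam β γ hω hl hβ hγ hU μ hμ T hT D hD
  obtain ⟨C, hC⟩ := hGK ω₂ lam β γ hω hl hβ hγ T hT
  refine bddAbove_range_abs_of_eventually_abs_le (C := 2 * C / T ^ 2) ?_
  filter_upwards [hC, eventually_ge_atTop 2] with N hN h2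
  have hKN := (hK ω₂ lam β γ hω hl hβ hγ hU μ hμ T hT N (D N) (hD N)).2
  simp only [] at hKN
  -- `hKN : (↑N - 1) * T ^ 2 * D N = GK_N`
  have hN2 : (2 : ℝ) ≤ N := by exact_mod_cast h2
  have hN1 : (0 : ℝ) < (N : ℝ) - 1 := by linarith
  have hT2 : (0 : ℝ) < T ^ 2 := by positivity
  have hC0 : 0 ≤ C := by
    have h0 : (0 : ℝ) ≤ C * N := le_trans (abs_nonneg _) hN
    have hNpos : (0 : ℝ) < N := by linarith
    nlinarith
  have habs : ((N : ℝ) - 1) * T ^ 2 * |D N| ≤ C * N := by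
    have : |((N : ℝ) - 1) * T ^ 2 * D N| = ((N : ℝ) - 1) * T ^ 2 * |D N| := by
      rw [abs_mul, abs_of_pos (mul_pos hN1 hT2)]
    rw [← this, hKN]
    exact hN
  have hle : |D N| ≤ C * N / (((N : ℝ) - 1) * T ^ 2) := by
    rw [le_div_iff₀ (mul_pos hN1 hT2)]
    linarith [habs]
  calc |D N| ≤ C * N / (((N : ℝ) - 1) * T ^ 2) := hle
    _ ≤ 2 * C / T ^ 2 := by
        rw [div_le_div_iff₀ (mul_pos hN1 hT2) hT2]
        have : C * (N : ℝ) ≤ 2 * C * ((N : ℝ) - 1) := by nlinarith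
        nlinarith [this, hT2.le]

/-- The same reduction from `CorrectorTheory` (whose second conjunct is the Kubo identity): an
`O(N)` bound on the equilibrium Green–Kubo integral of the total current closes `BoundedResponse`.
[folklore] -/
theorem boundedResponse_of_correctorTheory_of_gk_abs_le
    (hCT : OddSectorIrreversibility.CorrectorTheory)
    (hGK : ∀ ω₂ lam β γ : ℝ, 0 < ω₂ → 0 < lam → 0 < β → 0 < γ → ∀ T : ℝ, 0 < T →
      ∃ C : ℝ, ∀ᶠ N : ℕ in atTop,
        |∫ t in Ioi (0 : ℝ), ∫ z, (∑ i : Fin N, (pinnedChain ω₂ lam β γ).bondCurrent N i z) *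
            (∫ y, (∑ i : Fin N, (pinnedChain ω₂ lam β γ).bondCurrent N i y)
              ∂((pinnedChain ω₂ lam β γ).transitionKernel N T T t.toNNReal z))
          ∂((pinnedChain ω₂ lam β γ).gibbsMeasure N T)| ≤ C * N) :
    OddSectorIrreversibility.BoundedResponse :=
  boundedResponse_of_kuboAbelIdentity_of_gk_abs_le (kuboAbelIdentity_of_correctorTheory hCT) hGK

/-- **Converse: the reduction is lossless.** Under weak-NESS uniqueness, the Kubo identity, the
existence of the response coefficients (`FiniteResponseOfUnique`) and `BoundedResponse` give an
`O(N)` bound on the equilibrium Green–Kubo integral for ALL `N`: along the steady-state family through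
the landed existence theorem `pinnedChain_exists_isSteadyState`, `|GK_N| = (N-1) T² |D_N| ≤ T² B · N`
with `B = sup_N |D_N|` (`GK_N` itself does not depend on the family). [folklore] -/
theorem gk_abs_le_of_boundedResponse
    (hK : StaticAbelianSqueeze.KuboAbelIdentity)
    (hFR : OddSectorIrreversibility.FiniteResponseOfUnique)
    (hB : OddSectorIrreversibility.BoundedResponse)
    {ω₂ lam β γ : ℝ} (hω : 0 < ω₂) (hl : 0 < lam) (hβ : 0 < β) (hγ : 0 < γ)
    (hU : ∀ (N : ℕ) (T_L T_R : ℝ), 0 < T_L → 0 < T_R → ∀ μ ν : Measure (PhaseSpace N),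
      (pinnedChain ω₂ lam β γ).IsSteadyState N T_L T_R μ →
        (pinnedChain ω₂ lam β γ).IsSteadyState N T_L T_R ν → μ = ν)
    {T : ℝ} (hT : 0 < T) :
    ∃ C : ℝ, ∀ N : ℕ,
      |∫ t in Ioi (0 : ℝ), ∫ z, (∑ i : Fin N, (pinnedChain ω₂ lam β γ).bondCurrent N i z) *
          (∫ y, (∑ i : Fin N, (pinnedChain ω₂ lam β γ).bondCurrent N i y)
            ∂((pinnedChain ω₂ lam β γ).transitionKernel N T T t.toNNReal z))
        ∂((pinnedChain ω₂ lam β γ).gibbsMeasure N T)| ≤ C * N := by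
  classical
  -- a steady-state family from the landed existence theorem (junk `0` at non-positive temperatures)
  have hex : ∀ (N : ℕ) (T_L T_R : ℝ), 0 < T_L → 0 < T_R →
      ∃ μ : Measure (PhaseSpace N), (pinnedChain ω₂ lam β γ).IsSteadyState N T_L T_R μ :=
    fun N T_L T_R h1 h2 => pinnedChain_exists_isSteadyState hω hl hβ hγ N h1 h2
  let μ₀ : (N : ℕ) → ℝ → ℝ → Measure (PhaseSpace N) := fun N T_L T_R =>
    if h12 : 0 < T_L ∧ 0 < T_R then Classical.choose (hex N T_L T_R h12.1 h12.2) else 0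
  have hμ₀ : ∀ (N : ℕ) (T_L T_R : ℝ), 0 < T_L → 0 < T_R →
      (pinnedChain ω₂ lam β γ).IsSteadyState N T_L T_R (μ₀ N T_L T_R) := by
    intro N T_L T_R h1 h2
    simp only [μ₀, dif_pos (And.intro h1 h2)]
    exact Classical.choose_spec (hex N T_L T_R h1 h2)
  -- the response coefficients along `μ₀` exist (`FiniteResponseOfUnique`) and are bounded
  choose D hD using fun N => hFR ω₂ lam β γ hω hl hβ hγ hU μ₀ hμ₀ T hT N
  obtain ⟨B, hBD⟩ := hB ω₂ lam β γ hω hl hβ hγ hU μ₀ hμ₀ T hT D hD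
  have hBN : ∀ N, |D N| ≤ B := fun N => hBD ⟨N, rfl⟩
  have hB0 : 0 ≤ B := le_trans (abs_nonneg _) (hBN 0)
  refine ⟨T ^ 2 * B, fun N => ?_⟩
  have hKN := (hK ω₂ lam β γ hω hl hβ hγ hU μ₀ hμ₀ T hT N (D N) (hD N)).2
  simp only [] at hKN
  rw [← hKN, abs_mul, abs_mul, abs_of_nonneg (sq_nonneg T)]
  have hT2 : (0 : ℝ) ≤ T ^ 2 := sq_nonneg T
  rcases Nat.eq_zero_or_pos N with h0 | hpos
  · subst h0
    -- the empty chain: `D 0 = 0` (`totalCurrent ≡ 0`, limits along `𝓝[≠] 0` are unique)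
    have hD0 : D 0 = 0 :=
      responseCoeff_eq_zero_of_le_one (pinnedChain ω₂ lam β γ) (Nat.zero_le 1) (μ₀ 0) (hD 0)
    simp [hD0]
  · have hN1 : |(N : ℝ) - 1| = (N : ℝ) - 1 := by
      apply abs_of_nonneg
      have : (1 : ℝ) ≤ N := by exact_mod_cast hpos
      linarith
    rw [hN1]
    have h1 : ((N : ℝ) - 1) * T ^ 2 * |D N| ≤ ((N : ℝ) - 1) * T ^ 2 * B :=
      mul_le_mul_of_nonneg_left (hBN N) (mul_nonneg (by linarith [hN1 ▸ abs_nonneg ((N : ℝ) - 1)]) hT2)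
    nlinarith [h1, hB0, hT2]

end Summit.AtomisticToContinuum.FouriersLaw.Theorems

end
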